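import Literature.Probability.RandomPlanarGeometry.SAWWidePolygonsJoinCount
import Literature.Probability.RandomPlanarGeometry.SAWPolygonClasses
import Literature.Probability.RandomPlanarGeometry.SAWPolygonOpening
import Literature.Probability.LatticeModels.ThermodynamicLimit
import HarnessLib

/-!
# Super-multiplicativity of the fixed-endpoint counts `c_n(0,e↓)` on `ℤ²` (polygon concatenation) and the
# symmetry `c_n(0,x) = c_n(0,e↓)` for the four neighbours `x` of the origin

Topic `Literature/Probability/RandomPlanarGeometry` (continues `SAWWidePolygonsJoinCount.lean`: the DGHM join
`J(p,τq)` and its code `joinCode`; `SAWPolygonClasses.lean`: `(3.2.1)`-type bound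
`countAt_le_card_box_mul_card_normPolygons`; `SAWPolygonOpening.lean`: `openList`).

Source: N. Madras, G. Slade, *The Self-Avoiding Walk* (1993), §3.2: Theorem 3.2.3 ("`q_n q_m ≤ q_{n+m}`" in
`d = 2`, polygon concatenation, (3.2.2)) and (3.2.1) (`2N q_N = 2d c_{N-1}(0,e)`, polygons versus walks closing
at a neighbour of the origin).  We prove the lossy quantitative forms that the lane's fixed-endpoint ratio-rate
theorem consumes:

* `card_normPolygons_mul_le` — `|P_a| · |P_b| ≤ (2(a+b)+1)² · |P_{a+b}|` (`P_k` = normal `k`-edge polygons;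
  the pair is recovered from the normalised join and the position of `EN(p)`, `eq_of_joinCode_eq`);
* `card_normPolygons_le_countAt` — `|P_{k+1}| ≤ c_k(0,e↓)` (open the polygon at the plaquette edge below `EN`);
* **`countAt_eDown_supermul`** — `c_n(0,e↓) c_m(0,e↓) ≤ (2n+3)²(2m+3)²(2(n+m+2)+1)² c_{n+m+1}(0,e↓)`, `n, m ≥ 2`;
* **`countAt_eq_countAt_eDown_of_normOne`** — `c_n(0,x) = c_n(0,e↓)` whenever `‖x‖₁ = 1` (lattice symmetries).
-/

noncomputable section

open Finset Literature.Probability.LatticeModels Literature.Probability.Percolation SimpleGraph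
open Literature.Barriers.CriticalPhenomena.SupercriticalSAW (shiftEdges isPolygon_shiftEdges
  card_shiftEdges mem_shiftEdges_iff shiftEdges_injective)
open Literature.Probability.Percolation.SiteGadgetSystem (vertsOf mem_vertsOf)
open scoped BigOperators

namespace Literature.Probability.RandomPlanarGeometry.SAW

/-! ### `|P_a| · |P_b| ≤ (2(a+b)+1)² |P_{a+b}|` -/

/-- The join code lands in `P_{a+b} × [-(a+b), a+b]²`. [cite: MadrasSlade1993, Theorem 3.2.3 (polygon concatenation, eq. (3.2.2))] -/
theorem joinCode_mem {a b : ℕ} {p q : Finset (Sym2 (Site 2))} (hp : p ∈ normPolygons a) (hq : q ∈ normPolygons b) :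
    joinCode (p, q) ∈ normPolygons (a + b) ×ˢ box 2 (a + b) := by
  obtain ⟨hpP, hpc, -⟩ := mem_normPolygons.1 hp
  obtain ⟨hqP, hqc, -⟩ := mem_normPolygons.1 hq
  obtain ⟨hJ, hJc⟩ := isPolygon_dghmJoin hpP hqP
  have hN : IsNormal (shiftEdges (nshift (dghmJoin p q)) (dghmJoin p q)) := by
    rw [← normalise_eq_shiftEdges_nshift]; exact isNormal_normalise hJ.vertsOf_nonempty
  have hcard : (shiftEdges (nshift (dghmJoin p q)) (dghmJoin p q)).card = a + b := by
    rw [card_shiftEdges, hJc, hpc, hqc]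
  refine Finset.mem_product.2 ⟨?_, ?_⟩
  · simp only [joinCode]
    rw [mem_normPolygons, normalise_eq_shiftEdges_nshift]
    exact ⟨isPolygon_shiftEdges hJ _, hcard, hN⟩
  · have hmem : enV p + nshift (dghmJoin p q) ∈ vertsOf (shiftEdges (nshift (dghmJoin p q)) (dghmJoin p q)) :=
      add_mem_vertsOf_shiftEdges.2 (vertsOf_subset_vertsOf_dghmJoin hpP (isEN_enV hpP.vertsOf_nonempty).1)
    rw [mem_box]
    intro i
    have := coord_mem_Icc_of_isNormal (isPolygon_shiftEdges hJ _) hN hmem i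
    rw [hcard] at this
    simp only [joinCode]
    push_cast at this ⊢
    constructor <;> linarith [this.1, this.2]

/-- **`|P_a| · |P_b| ≤ (2(a+b)+1)² · |P_{a+b}|`** (Theorem 3.2.3, lossy form: the join is injective given the position of
`EN(p)`). [cite: MadrasSlade1993, Theorem 3.2.3, eq. (3.2.2)] -/
theorem card_normPolygons_mul_le (a b : ℕ) :
    (normPolygons a).card * (normPolygons b).card ≤ (2 * (a + b) + 1) ^ 2 * (normPolygons (a + b)).card := by
  classical
  rw [← Finset.card_product]
  calc ((normPolygons a) ×ˢ (normPolygons b)).card ≤ (normPolygons (a + b) ×ˢ box 2 (a + b)).card := by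
        refine Finset.card_le_card_of_injOn joinCode (fun pq hpq => ?_) ?_
        · rw [Finset.mem_coe, Finset.mem_product] at hpq
          exact joinCode_mem hpq.1 hpq.2
        · rintro ⟨p, q⟩ hpq ⟨p', q'⟩ hpq' h
          rw [Finset.mem_coe, Finset.mem_product] at hpq hpq'
          obtain ⟨hpP, -, hpN⟩ := mem_normPolygons.1 hpq.1
          obtain ⟨hqP, -, hqN⟩ := mem_normPolygons.1 hpq.2
          obtain ⟨hp'P, -, hp'N⟩ := mem_normPolygons.1 hpq'.1
          obtain ⟨hq'P, -, hq'N⟩ := mem_normPolygons.1 hpq'.2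
          obtain ⟨h1, h2⟩ := eq_of_joinCode_eq hpP hqP hp'P hq'P hpN hqN hp'N hq'N h
          exact Prod.ext h1 h2
    _ = (2 * (a + b) + 1) ^ 2 * (normPolygons (a + b)).card := by rw [Finset.card_product, card_box]; ring

/-! ### `|P_{k+1}| ≤ c_k(0,e↓)`: opening at the plaquette edge below `EN` -/

section Open

variable {E : Finset (Sym2 (Site 2))}

/-- The consecutive pairs of a list, by index. [folklore] -/
private theorem mem_pairEdges_iff_getElem' {V : Type*} {l : List V} {e : Sym2 V} :
    e ∈ pairEdges l ↔ ∃ (i : ℕ) (h : i + 1 < l.length), e = s(l[i], l[i + 1]) := by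
  induction l with
  | nil => simp
  | cons a l ih =>
    cases l with
    | nil => simp
    | cons b l =>
      rw [pairEdges_cons_cons, List.mem_cons, ih]
      constructor
      · rintro (rfl | ⟨i, hi, rfl⟩)
        · exact ⟨0, by simp, by simp⟩
        · exact ⟨i + 1, by simpa using hi, by simp⟩
      · rintro ⟨i, hi, rfl⟩
        cases i with
        | zero => exact Or.inl (by simp)
        | succ i => exact Or.inr ⟨i, by simpa using hi, by simp⟩

/-- The opened polygon (at `{EN, EN − e₁}`), as a vertex list. [folklore] -/
private def polyList' (E : Finset (Sym2 (Site 2))) : List (Site 2) := openList (zdGraph 2) E (enV E) (enV E - ey)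

/-- The `i`-th vertex of the opened polygon. [folklore] -/
private def polyFun' (E : Finset (Sym2 (Site 2))) (i : ℕ) : Site 2 := (polyList' E).getD i 0

/-- (plumbing for the rooted walk of a polygon) [folklore] -/
private theorem edgeEN_mem' (hE : IsPolygon (zdGraph 2) E) : s(enV E, enV E - ey) ∈ E :=
  edge_down_mem_of_isEN hE (isEN_enV hE.vertsOf_nonempty)

/-- (plumbing for the rooted walk of a polygon) [folklore] -/
private theorem polyList'_spec (hE : IsPolygon (zdGraph 2) E) :
    (polyList' E).IsChain (zdGraph 2).Adj ∧ (polyList' E).Nodup ∧ (polyList' E).head? = some (enV E) ∧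
      (polyList' E).getLast? = some (enV E - ey) ∧ (polyList' E).length = E.card ∧ 3 ≤ E.card ∧
      (pairEdges (polyList' E)).toFinset = E.erase s(enV E, enV E - ey) := by
  have h := openList_spec hE (edgeEN_mem' hE)
  exact ⟨h.1, h.2.1, h.2.2.1, h.2.2.2.1, h.2.2.2.2.1, h.2.2.2.2.2.1, h.2.2.2.2.2.2.1⟩

/-- (plumbing for the rooted walk of a polygon) [folklore] -/
private theorem length_polyList' (hE : IsPolygon (zdGraph 2) E) : (polyList' E).length = E.card := (polyList'_spec hE).2.2.2.2.1

/-- (plumbing for the rooted walk of a polygon) [folklore] -/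
private theorem polyFun'_eq (hE : IsPolygon (zdGraph 2) E) {i : ℕ} (hi : i < E.card) :
    polyFun' E i = (polyList' E)[i]'(by rw [length_polyList' hE]; exact hi) := by
  unfold polyFun'
  rw [List.getD_eq_getElem?_getD, List.getElem?_eq_getElem (by rw [length_polyList' hE]; exact hi), Option.getD_some]

/-- (plumbing for the rooted walk of a polygon) [folklore] -/
private theorem polyFun'_zero (hE : IsPolygon (zdGraph 2) E) : polyFun' E 0 = enV E := by
  have h3 := (polyList'_spec hE).2.2.2.2.2.1
  rw [polyFun'_eq hE (by omega)]
  have h := (polyList'_spec hE).2.2.1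
  rw [List.head?_eq_getElem?, List.getElem?_eq_getElem (by rw [length_polyList' hE]; omega)] at h
  exact Option.some.inj h

/-- (plumbing for the rooted walk of a polygon) [folklore] -/
private theorem polyFun'_last (hE : IsPolygon (zdGraph 2) E) : polyFun' E (E.card - 1) = enV E - ey := by
  have h3 := (polyList'_spec hE).2.2.2.2.2.1
  rw [polyFun'_eq hE (by omega)]
  have h := (polyList'_spec hE).2.2.2.1
  rw [List.getLast?_eq_getElem?, List.getElem?_eq_getElem (by rw [length_polyList' hE]; omega)] at h
  simp only [length_polyList' hE] at h
  exact Option.some.inj h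

/-- (plumbing for the rooted walk of a polygon) [folklore] -/
private theorem polyFun'_adj (hE : IsPolygon (zdGraph 2) E) {i : ℕ} (hi : i + 1 < E.card) :
    (zdGraph 2).Adj (polyFun' E i) (polyFun' E (i + 1)) := by
  rw [polyFun'_eq hE (by omega), polyFun'_eq hE hi]
  exact List.isChain_iff_getElem.1 (polyList'_spec hE).1 i (by rw [length_polyList' hE]; exact hi)

/-- (plumbing for the rooted walk of a polygon) [folklore] -/
private theorem polyFun'_injOn (hE : IsPolygon (zdGraph 2) E) : Set.InjOn (polyFun' E) {i | i ≤ E.card - 1} := by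
  intro i hi j hj hij
  have h3 := (polyList'_spec hE).2.2.2.2.2.1
  simp only [Set.mem_setOf_eq] at hi hj
  rw [polyFun'_eq hE (by omega), polyFun'_eq hE (by omega)] at hij
  exact ((polyList'_spec hE).2.1.getElem_inj_iff).1 hij

/-- (plumbing for the rooted walk of a polygon) [folklore] -/
private theorem eq_edges_polyFun' (hE : IsPolygon (zdGraph 2) E) :
    E = insert s(polyFun' E (E.card - 1), polyFun' E 0)
      ((Finset.range (E.card - 1)).image fun i => s(polyFun' E i, polyFun' E (i + 1))) := by
  have h3 := (polyList'_spec hE).2.2.2.2.2.1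
  have hpe := (polyList'_spec hE).2.2.2.2.2.2
  rw [polyFun'_last hE, polyFun'_zero hE, Sym2.eq_swap]
  have : ((Finset.range (E.card - 1)).image fun i => s(polyFun' E i, polyFun' E (i + 1))) =
      (pairEdges (polyList' E)).toFinset := by
    ext e
    rw [Finset.mem_image, List.mem_toFinset, mem_pairEdges_iff_getElem']
    constructor
    · rintro ⟨i, hi, rfl⟩
      rw [Finset.mem_range] at hi
      exact ⟨i, by rw [length_polyList' hE]; omega, by rw [polyFun'_eq hE (by omega), polyFun'_eq hE (by omega)]⟩
    · rintro ⟨i, hi, rfl⟩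
      rw [length_polyList' hE] at hi
      exact ⟨i, Finset.mem_range.2 (by omega), by rw [polyFun'_eq hE (by omega), polyFun'_eq hE (by omega)]⟩
  rw [this, hpe, Finset.insert_erase (edgeEN_mem' hE)]

/-- (plumbing for the rooted walk of a polygon) [folklore] -/
private theorem neg_ey_eq_eDown' : -(ey : Site 2) = Zd.eDown := by
  funext i; fin_cases i <;> simp [ey, Zd.eDown]

/-- The rooted walk of a polygon: open at `{EN, EN − e₁}`, translate `EN` to the origin. [folklore] -/
def rootWalk (E : Finset (Sym2 (Site 2))) (i : ℕ) : Site 2 := polyFun' E (min i (E.card - 1)) - enV E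

/-- **The rooted walk of a `(k+1)`-edge polygon is a `k`-step self-avoiding walk from `0` to `e↓`.**
[cite: MadrasSlade1993, §3.2, eq. (3.2.1) (polygons versus walks ending next to the origin)] -/
theorem rootWalk_mem_sawFun (hE : IsPolygon (zdGraph 2) E) : rootWalk E ∈ Zd.sawFun 2 (E.card - 1) Zd.eDown := by
  have h3 := (polyList'_spec hE).2.2.2.2.2.1
  refine Zd.mem_sawFun.2 ⟨by simp [rootWalk, polyFun'_zero hE], fun i hi => ?_, fun i hi => ?_, ?_⟩
  · unfold rootWalk
    rw [min_eq_right hi, polyFun'_last hE, sub_sub_cancel_left, neg_ey_eq_eDown']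
  · unfold rootWalk
    rw [min_eq_left hi.le, min_eq_left (by omega), Zd.zdGraph_adj_sub_right]
    exact polyFun'_adj hE (by omega)
  · intro i hi j hj hij
    simp only [Set.mem_setOf_eq] at hi hj
    unfold rootWalk at hij
    rw [min_eq_left hi, min_eq_left hj] at hij
    exact polyFun'_injOn hE hi hj (sub_left_injective hij)

/-- The rooted walk determines the (normal) polygon: its traced edges are a translate of `E`. [folklore] -/
private theorem shiftEdges_eq_of_rootWalk (hE : IsPolygon (zdGraph 2) E) :
    insert s(rootWalk E (E.card - 1), rootWalk E 0)
        ((Finset.range (E.card - 1)).image fun i => s(rootWalk E i, rootWalk E (i + 1))) =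
      shiftEdges (-enV E) E := by
  have h3 := (polyList'_spec hE).2.2.2.2.2.1
  have key : ∀ i, i ≤ E.card - 1 → rootWalk E i = polyFun' E i + -enV E := by
    intro i hi; unfold rootWalk; rw [min_eq_left hi]; abel
  have himg : ((Finset.range (E.card - 1)).image fun i => s(rootWalk E i, rootWalk E (i + 1))) =
      (Finset.range (E.card - 1)).image
        ((Sym2.map fun v : Site 2 => v + -enV E) ∘ fun i => s(polyFun' E i, polyFun' E (i + 1))) := by
    refine Finset.image_congr fun i hi => ?_
    rw [Finset.mem_coe, Finset.mem_range] at hi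
    rw [key i (by omega), key (i + 1) (by omega), Function.comp_apply, Sym2.map_mk]
  rw [himg, key _ le_rfl, key 0 (Nat.zero_le _)]
  conv_rhs => arg 2; rw [eq_edges_polyFun' hE]
  rw [shiftEdges_insert, shiftEdges, Finset.image_image, Sym2.map_mk]

/-- **`|P_{k+1}| ≤ c_k(0,e↓)`** (`k ≥ 2`): rooting is injective on normal polygons.
[cite: MadrasSlade1993, §3.2, eq. (3.2.1)] -/
theorem card_normPolygons_le_countAt (k : ℕ) : (normPolygons (k + 1)).card ≤ Zd.countAt 2 k Zd.eDown := by
  classical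
  rw [← Zd.card_sawFun]
  refine Finset.card_le_card_of_injOn rootWalk (fun E hE => ?_) ?_
  · rw [Finset.mem_coe, mem_normPolygons] at hE
    have := rootWalk_mem_sawFun hE.1
    rw [hE.2.1, Nat.add_sub_cancel] at this
    exact this
  · intro E hE E' hE' h
    rw [Finset.mem_coe, mem_normPolygons] at hE hE'
    have h1 := shiftEdges_eq_of_rootWalk hE.1
    have h2 := shiftEdges_eq_of_rootWalk hE'.1
    rw [hE.2.1] at h1; rw [hE'.2.1] at h2
    have : shiftEdges (-enV E) E = shiftEdges (-enV E') E' := by rw [← h1, ← h2, h]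
    have := congrArg normalise this
    rwa [normalise_shiftEdges, normalise_shiftEdges, normalise_eq_self hE.2.2, normalise_eq_self hE'.2.2] at this

end Open

/-! ### Super-multiplicativity of `c_n(0,e↓)` -/

/-- **`c_n(0,e↓) · c_m(0,e↓) ≤ (2n+3)² (2m+3)² (2(n+m+2)+1)² · c_{n+m+1}(0,e↓)`** for `n, m ≥ 2`
(walks closing next to the origin ↦ polygons (3.2.1), concatenate (3.2.2), re-open).
[cite: MadrasSlade1993, Theorem 3.2.3, eqs. (3.2.1)–(3.2.2)] -/
theorem countAt_eDown_supermul {n m : ℕ} (hn : 2 ≤ n) (hm : 2 ≤ m) :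
    Zd.countAt 2 n Zd.eDown * Zd.countAt 2 m Zd.eDown ≤
      (2 * (n + 1) + 1) ^ 2 * (2 * (m + 1) + 1) ^ 2 * (2 * (n + m + 2) + 1) ^ 2 * Zd.countAt 2 (n + m + 1) Zd.eDown := by
  have h1 := countAt_le_card_box_mul_card_normPolygons adj_eDown_zero hn
  have h2 := countAt_le_card_box_mul_card_normPolygons adj_eDown_zero hm
  have h3 := card_normPolygons_mul_le (n + 1) (m + 1)
  have h4 := card_normPolygons_le_countAt (n + m + 1)
  rw [show n + 1 + (m + 1) = n + m + 1 + 1 by ring] at h3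
  calc Zd.countAt 2 n Zd.eDown * Zd.countAt 2 m Zd.eDown
      ≤ ((2 * (n + 1) + 1) ^ 2 * (normPolygons (n + 1)).card) * ((2 * (m + 1) + 1) ^ 2 * (normPolygons (m + 1)).card) :=
        Nat.mul_le_mul h1 h2
    _ = (2 * (n + 1) + 1) ^ 2 * (2 * (m + 1) + 1) ^ 2 * ((normPolygons (n + 1)).card * (normPolygons (m + 1)).card) := by ring
    _ ≤ (2 * (n + 1) + 1) ^ 2 * (2 * (m + 1) + 1) ^ 2 * ((2 * (n + m + 1 + 1) + 1) ^ 2 * (normPolygons (n + m + 1 + 1)).card) :=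
        Nat.mul_le_mul_left _ h3
    _ ≤ (2 * (n + 1) + 1) ^ 2 * (2 * (m + 1) + 1) ^ 2 * ((2 * (n + m + 1 + 1) + 1) ^ 2 * Zd.countAt 2 (n + m + 1) Zd.eDown) :=
        Nat.mul_le_mul_left _ (Nat.mul_le_mul_left _ h4)
    _ = _ := by ring

/-! ### Symmetry over the four neighbours of the origin -/

namespace Zd

/-- Swapping the two coordinates of `ℤ²`. [folklore] -/
def swapSite (x : Site 2) : Site 2 := fun i => x (Equiv.swap 0 1 i)

/-- `swapSite` is an involution. [folklore] -/
private theorem swapSite_swapSite (x : Site 2) : swapSite (swapSite x) = x := by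
  funext i; simp [swapSite, Equiv.swap_apply_self]

/-- `swapSite` preserves adjacency. [folklore] -/
private theorem zdGraph_adj_swapSite {x y : Site 2} (h : (zdGraph 2).Adj x y) : (zdGraph 2).Adj (swapSite x) (swapSite y) := by
  rw [zdGraph_adj_iff] at h ⊢
  obtain ⟨i, h | h⟩ := h
  · refine ⟨Equiv.swap 0 1 i, Or.inl ?_⟩
    funext j
    simp only [swapSite, h, Pi.add_apply, Pi.single_apply]
    rcases eq_or_ne (Equiv.swap 0 1 j) i with hj | hj
    · rw [if_pos hj, if_pos]; rw [← hj, Equiv.swap_apply_self]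
    · rw [if_neg hj, if_neg]; intro hji; apply hj; rw [hji, Equiv.swap_apply_self]
  · refine ⟨Equiv.swap 0 1 i, Or.inr ?_⟩
    funext j
    simp only [swapSite, h, Pi.add_apply, Pi.single_apply]
    rcases eq_or_ne (Equiv.swap 0 1 j) i with hj | hj
    · rw [if_pos hj, if_pos]; rw [← hj, Equiv.swap_apply_self]
    · rw [if_neg hj, if_neg]; intro hji; apply hj; rw [hji, Equiv.swap_apply_self]

/-- Swapping coordinates maps `sawFun 2 n x` into `sawFun 2 n (swapSite x)`. [cite: MadrasSlade1993, §1.1 (lattice symmetry)] -/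
theorem swap_mem_sawFun {n : ℕ} {x : Site 2} {ω : ℕ → Site 2} (h : ω ∈ sawFun 2 n x) :
    (fun i => swapSite (ω i)) ∈ sawFun 2 n (swapSite x) := by
  obtain ⟨h0, hend, hadj, hinj⟩ := mem_sawFun.1 h
  refine mem_sawFun.2 ⟨by rw [h0]; rfl, fun i hi => by rw [hend i hi], fun i hi => zdGraph_adj_swapSite (hadj i hi),
    fun i hi j hj hij => ?_⟩
  have : ω i = ω j := by
    have := congrArg swapSite hij
    simpa [swapSite_swapSite] using this
  exact hinj hi hj this

/-- **`c_n(0, swap x) = c_n(0,x)`** on `ℤ²`. [cite: MadrasSlade1993, §1.1 (lattice symmetry)] -/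
theorem countAt_swapSite (n : ℕ) (x : Site 2) : countAt 2 n (swapSite x) = countAt 2 n x := by
  have key : ∀ y : Site 2, countAt 2 n y ≤ countAt 2 n (swapSite y) := fun y => by
    rw [← card_sawFun, ← card_sawFun]
    refine Finset.card_le_card_of_injOn (fun ω i => swapSite (ω i)) (fun ω hω => swap_mem_sawFun hω) ?_
    intro ω₁ _ ω₂ _ h
    funext i
    have := congrFun h i
    have := congrArg swapSite this
    simpa [swapSite_swapSite] using this
  refine le_antisymm ?_ (key x)
  have := key (swapSite x)
  rwa [swapSite_swapSite] at this

/-- The four sites of `ℤ²` with `‖x‖₁ = 1`. [folklore] -/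
private theorem eq_of_normOne_eq_one {x : Site 2} (hx : normOne x = 1) :
    x = eDown ∨ x = -eDown ∨ x = swapSite eDown ∨ x = -swapSite eDown := by
  unfold normOne at hx
  rw [Fin.sum_univ_two] at hx
  have h0 : (x 0).natAbs ≤ 1 := by omega
  have h1 : (x 1).natAbs ≤ 1 := by omega
  have e : ∀ y : Site 2, x = y ↔ x 0 = y 0 ∧ x 1 = y 1 := fun y =>
    ⟨fun h => by rw [h]; exact ⟨rfl, rfl⟩, fun h => by funext i; fin_cases i <;> simp [h.1, h.2]⟩
  simp only [e, eDown, swapSite, Pi.neg_apply, Equiv.swap_apply_left, Equiv.swap_apply_right,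
    Matrix.cons_val_zero, Matrix.cons_val_one]
  omega

/-- **`c_n(0,x) = c_n(0,e↓)` for every neighbour `x` of the origin of `ℤ²`** (`‖x‖₁ = 1`).
[cite: MadrasSlade1993, §1.1 (lattice symmetry)] -/
theorem countAt_eq_countAt_eDown_of_normOne {x : Site 2} (hx : normOne x = 1) (n : ℕ) :
    countAt 2 n x = countAt 2 n eDown := by
  rcases eq_of_normOne_eq_one hx with h | h | h | h <;> rw [h]
  · rw [countAt_neg]
  · rw [countAt_swapSite]
  · rw [countAt_neg, countAt_swapSite]

end Zd

end Literature.Probability.RandomPlanarGeometry.SAW
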